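import Summits.ResolutionOfSingularities.ResolutionOfSingularities.Theorems.HeightLaw
import HarnessLib

/-!
# HeightTowers — decomp-res node «HeightCut» (lens-4 g25, critic row 151), tree file 2/4 of the node

Content VERBATIM from the decomp-res lens-4 g25 node `HOME/decomp-res-lens-4/g25/HeightCut.lean` (pin 3caeb106, 1
322 l; HOME = run/shared/lean/pub/decomp-res):
its NEW PART ONLY, l. 815–1320 (§64, §64b, §65; 26 declarations) — the carried block l. 79–811 (= row
148a's landing unit `KangarooCutTree` 76e53063,
machine diff empty) is ALREADY in the tree as `Theorems/PPowerSpan` · `KangarooTransport` · `KangarooTowers` ·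
`KangarooCutCells` · `MaxContactCutKangarooCut`
and is DELETED ON LANDING as the lens instructs.  Critic: CRITIC-LEDGER row 151 (CLEARED 2026-08-30T22:50:05Z,
DECIDED +1 (i*) at p = 2 = n: the WEIGHT-TWO
HEIGHT LAW in kernel empties the principal double-point/dim-4 cell; exact re-location to
`NoWildKangarooOffDoublePointTowers`); landing orders INBOX :442/:444
(lens-4 g25) and :463 (critic): `HeightLaw` (§64) · `HeightTowers` (§64b) · `HeightCutCells` (§65), `--supports
stmt-ResolutionOfSingularities-28338`.  Landed by
decomp-res writer g8 in the lens's namespace `…Theorems.HugValuationCut`, CONE-AWARE: `HeightLaw`, `HeightTowers`,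
`HeightCutCells` are OUTSIDE the Theses
cone (importable by the route file); the two §65 up-links from the MaxContactCut item 31571
(`noWildPPowerOffLocusTowers_iff_g25 (h71)`,
`noWildContactFreeOffLocusTowers_iff_g25 (h71)`) are the in-cone wiring file `MaxContactCutHeightCut`.  Aside
bookkeeping (critic rows 148/151): the ONE
successor aside of the kangaroo column is filed directly as `NoWildKangarooOffDoublePointTowers` (home
`HeightCutCells`) SUPERSEDING 28338
`LCNoWildContactFreeOffLocusTowers` — exactness chain `noWildContactFreeOffLocusTowers_iff_pPower` (tree, every
field) ∘ `noWildPPowerOffLocusTowers_iff_kangaroo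
(h31571)` (tree, `MaxContactCutKangarooCut`) ∘ `noWildKangarooOffLocusTowers_iff_g25` (this node, hypothesis-free)
= `noWildContactFreeOffLocusTowers_iff_g25 (h71)`;
the decided cell `NoWildKangarooDoublePointTowers` is PROVED (`noWildKangarooDoublePointTowers_holds`) and is not filed.

§64b (l. 1115–1224) the law along lens-4's forced towers: `DoublePointAt`, `DimFourAt`, `DoublePointTower`,
`no_doublePointTower` and the stage lemmas
(section `HeightTowers`).  PROVED, 0 sorry.  Imports `HeightLaw`.  Cone-free.

[WRITER NOTE (decomp-res writer g8): section split only; namespace, universes, section variables and every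
declaration exactly as in the lens
(global `set_option` dropped; the lens's cone import `MaxContactCutTameCut` is replaced in the cone-free files by
the landed cone-free chain under
`KangarooCutCells` — `AbsoluteGiraudKernel` (`AbsoluteContactClasses.isRsopPart_one_of_not_mem_sq`,
`point_round_chart`), `…CentreSpread` (`centreSpread`),
`PPowerTowers`, `TameCutStage`, `LatencyCutCells`; the `open …Theses` line lives only in the wiring file).]

(Sources: Hauser2010Kangaroo; Moh1987; HauserPerlega2019; Hironaka1970Additive; CossartPiltant2008 §2;
CossartPiltant2019 Prop. 2.50; Kollar2007 Rem. 2.61.2; EGA IV₄ 16.11.2; StacksProject.)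
-/

noncomputable section

open CategoryTheory AlgebraicGeometry IsLocalRing
open Literature.AlgebraicGeometry.Resolution
open Summit.ResolutionOfSingularities.ResolutionOfSingularities.Theorems
open WeakOrderReduction ForcedTowerClasses DivergentTowerClasses MonomialTowerClasses
open HugDimensionClasses HugDimensionKernels SurfaceShadowClasses SurfaceShadowKernels
open NearPointCut (SingularClass)
open AbsoluteContactClasses (IsAbsContactAt SepResidueAt diffIdeal_restrict_le stalkMap_comp_toStalk_eq_stalkHom)
open scoped BigOperators

namespace Summit.ResolutionOfSingularities.ResolutionOfSingularities.Theorems.HugValuationCut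

/-! ### §64b  The law along lens-4's forced towers -/

section HeightTowers

variable {k : Type} [Field k]

/-- **A WEAK-CONTACT DOUBLE POINT, PRINCIPAL MODULO `𝔪⁴`** at `y` for the ideal sheaf `𝓘`: `f ∈ 𝓘_y ⊆
(f) + 𝔪_y⁴` with
`f ≡ c·z² (mod 𝔪_y³)`, `c` a unit, `z ∈ 𝔪_y ∖ 𝔪_y²` — the typed shape of the g25 cut (every
`2`-power-form stage with principal
weight-two stalk over a perfect field, `doublePointAt_of_isPrincipal` + g24 `weakContactAt_of_pPowerFormAt`; e.g. the census
forms `z² + (odd monomials)`). (Sources: Hauser2010Kangaroo §«weak contact»; Moh1987.) -/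
def DoublePointAt {Y : Scheme.{0}} (I : Y.IdealSheafData) (y : Y) : Prop :=
  ∃ f ∈ stalkIdeal I y, stalkIdeal I y ≤ Ideal.span {f} ⊔ maximalIdeal (Y.presheaf.stalk y) ^ 4 ∧
    ∃ z ∈ maximalIdeal (Y.presheaf.stalk y), z ∉ maximalIdeal (Y.presheaf.stalk y) ^ 2 ∧
      ∃ c : Y.presheaf.stalk y, IsUnit c ∧ f - c * z ^ 2 ∈ maximalIdeal (Y.presheaf.stalk y) ^ 3

/-- **stage `i` of the tower is a point of RING DIMENSION ≥ 4** (`dim 𝒪_{X_i, x_i} ≥ 4`; under `IsBase`, `dim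
≤ 4`, this is
«a closed point of a fourfold component»). [folklore] -/
def DimFourAt (T : ForcedTower) (i : ℕ) : Prop :=
  (4 : WithBot ℕ∞) ≤ ringKrullDim ((T.St i).presheaf.stalk (T.pt i))

/-- **the tower passes through a DOUBLE POINT WITH A DIM-4 SUCCESSOR**: some stage `j` is a weak-contact double point principal
modulo `𝔪⁴` and stage `j + 1` has ring dimension ≥ 4 — the cell the height law EMPTIES. [folklore] -/
def DoublePointTower (T : ForcedTower) : Prop :=
  ∃ j : ℕ, DoublePointAt (T.D j).ideal (T.pt j) ∧ DimFourAt T (j + 1)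

/-- **principal + weak contact ⟹ double point (KERNEL, PROVED)**: in a regular local ring, a PRINCIPAL weight-two stalk
`𝓘_y = (g) ⊆ 𝔪²` with weak contact at exponent two (`f ∈ 𝓘_y`, `f ≡ c z² mod 𝔪³`) is a
`DoublePointAt` with the same data:
`f = a·g`, and `a` is a unit because `z² ∉ 𝔪³` (order is a valuation, `mem_sq_of_pow_mem_pow_succ`), so `𝓘_y = (f)`.
[folklore] -/
theorem doublePointAt_of_isPrincipal {Y : Scheme.{0}} (I : Y.IdealSheafData) (y : Y)
    [IsRegularLocalRing (Y.presheaf.stalk y)] (hpr : (stalkIdeal I y).IsPrincipal)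
    (hI2 : stalkIdeal I y ≤ maximalIdeal _ ^ 2) (hW : WeakContactAt 2 I y) : DoublePointAt I y := by
  obtain ⟨z, hz, hz2, f, hfI, c, hc, hfz⟩ := hW
  obtain ⟨g, hg⟩ := hpr
  have hfg : f ∈ Ideal.span {g} := by rw [← Ideal.submodule_span_eq, ← hg]; exact hfI
  obtain ⟨a, rfl⟩ := Ideal.mem_span_singleton'.mp hfg
  -- `a` is a unit: otherwise `a g ∈ 𝔪³`, hence `c z² ∈ 𝔪³`, hence `z ∈ 𝔪²`
  have ha : IsUnit a := by
    by_contra hau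
    have ham : a ∈ maximalIdeal _ := by rwa [mem_maximalIdeal, mem_nonunits_iff]
    have hg2 : g ∈ maximalIdeal _ ^ 2 := hI2 (by rw [hg]; exact Ideal.mem_span_singleton_self g)
    have hag : a * g ∈ maximalIdeal _ ^ 3 := by
      rw [show (3 : ℕ) = 1 + 2 from rfl, pow_add, pow_one]; exact Ideal.mul_mem_mul ham hg2
    have hcz : c * z ^ 2 ∈ maximalIdeal _ ^ 3 := by
      have e : c * z ^ 2 = a * g - (a * g - c * z ^ 2) := by ring
      rw [e]; exact sub_mem hag hfz
    have hz3 : z ^ 2 ∈ maximalIdeal _ ^ (2 + 1) := (Ideal.unit_mul_mem_iff_mem _ hc).mp hcz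
    exact hz2 (mem_sq_of_pow_mem_pow_succ (by norm_num) hz3)
  refine ⟨a * g, hfI, ?_, z, hz, hz2, c, hc, hfz⟩
  intro w hw
  have hw' : w ∈ Ideal.span {g} := by rw [← Ideal.submodule_span_eq, ← hg]; exact hw
  refine Ideal.mem_sup_left ?_
  rw [Ideal.mem_span_singleton] at hw' ⊢
  exact ha.mul_left_dvd.mpr hw'

/-- **over a PERFECT field: a PRINCIPAL `2`-POWER-FORM STAGE OF WEIGHT TWO IS A DOUBLE POINT (KERNEL, PROVED)** — at stage
`j` of a forced tower of weight `2 = char k`, `PPowerFormAt 2 (T.D j).ideal 2 (T.pt j)` with principal stalk ⟹ `DoublePointAt`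
(g24 `weakContactAt_of_pPowerFormAt` at the closed point + `doublePointAt_of_isPrincipal`). (Sources: Hauser2010Kangaroo;
Hironaka1970Additive.) -/
theorem doublePointAt_stage_of_pPowerFormAt [CharP k 2] [PerfectField k] (T : ForcedTower)
    (g : T.St 0 ⟶ Spec (.of k)) (hB : IsBase (T.St 0) g) (hD : IsDatum 2 (T.D 0)) (j : ℕ)
    (hP : PPowerFormAt 2 (T.D j).ideal 2 (T.pt j)) (hpr : (stalkIdeal (T.D j).ideal (T.pt j)).IsPrincipal) :
    DoublePointAt (T.D j).ideal (T.pt j) := by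
  obtain ⟨-, hRj⟩ := tower_isLocallyNoetherian_isRegular T g hB j
  haveI : IsRegularLocalRing ((T.St j).presheaf.stalk (T.pt j)) := hRj _
  haveI : LocallyOfFiniteType (toRoot T j ≫ g) := (tower_isBase T g hB j).locallyOfFiniteType
  exact doublePointAt_of_isPrincipal _ _ hpr (tower_stalkIdeal_le_pow T hD j)
    (weakContactAt_of_pPowerFormAt Nat.prime_two (toRoot T j ≫ g) (T.D j).ideal (T.isClosed_pt j)
      (tower_idealOrder_pt_eq T g hB hD j) hP)

/-- **THE WEIGHT-TWO HEIGHT LAW ALONG FORCED TOWERS (KERNEL, PROVED — every field, every characteristic): A DOUBLE POINT HAS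
NO DIM-4 SUCCESSOR.**  In a forced point tower of weight two over a field, no stage `j` is a weak-contact double point principal
modulo `𝔪⁴` with `dim 𝒪_{x_{j+1}} ≥ 4`: the marked point `x_{j+1}` would have a proper generization in
`Sing(𝓘_{j+1}, 2)`
(`exists_generization_of_doublePoint`), contradicting `ForcedTower.isolated (j+1)`. (Sources: the height count, §64; setting
Hauser2010Kangaroo, Moh1987.) -/
theorem no_successor_of_doublePointAt (T : ForcedTower) (g : T.St 0 ⟶ Spec (.of k)) (hB : IsBase (T.St 0) g)
    (hD : IsDatum 2 (T.D 0)) (j : ℕ) (h : DoublePointAt (T.D j).ideal (T.pt j)) (h4 : DimFourAt T (j + 1)) : False := by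
  obtain ⟨hNj, hRj⟩ := tower_isLocallyNoetherian_isRegular T g hB j
  obtain ⟨hNj1, -⟩ := tower_isLocallyNoetherian_isRegular T g hB (j + 1)
  haveI := hNj
  haveI := hNj1
  haveI : IsNoetherian (T.St j) := tower_isNoetherian T g hB j
  have hπ := T.isBlowup j
  have hy : (T.π j).base (T.pt (j + 1)) = T.pt j := T.pt_map j
  have hDj1 : (T.D (j + 1)).ideal = controlledTransform (T.π j) (T.centre j) (T.D j).ideal 2 := by
    rw [T.transform_eq j, MarkedIdeal.transform_ideal, tower_mult_eq T hD j]
  have h' : DoublePointAt (T.D j).ideal ((T.π j).base (T.pt (j + 1))) := by rw [hy]; exact h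
  obtain ⟨f, hfI, hIf, z, hz1, hz2, c, hc, hfz⟩ := h'
  -- spread the contact parameter to a germ ideal `H` with `H_x = (z)`
  have hz0 : z ≠ 0 := fun h0 => hz2 (by rw [h0]; exact zero_mem _)
  have hspan : Ideal.span (Set.range fun _ : Fin 1 => z) = Ideal.span {z} := by rw [Set.range_const]
  obtain ⟨H, -, -, hHst⟩ := FInjectiveMacaulayfication.CentreSpread.centreSpread (T.St j) _ 1 (fun _ => z)
      (by rw [hspan, Ne, Ideal.span_singleton_eq_bot]; exact hz0)
      (by rw [hspan]; exact (Ideal.span_singleton_le_iff_mem _).mpr hz1)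
  rw [hspan] at hHst
  have hpt' : ((T.centre j).support : Set (T.St j)) = {(T.π j).base (T.pt (j + 1))} := by
    rw [hy]; exact T.centre_support j
  have hcl : IsClosed ({(T.π j).base (T.pt (j + 1))} : Set (T.St j)) := by rw [hy]; exact T.isClosed_pt j
  obtain ⟨ζ, hζ, hne, hζS⟩ := exists_generization_of_doublePoint hπ hRj (T.centre_regular j) (T.D j).ideal H
    (T.pt (j + 1)) hcl hpt' hfI hIf hHst hz1 hz2 hc hfz h4 (T.D (j + 1)) hDj1 (tower_mult_eq T hD (j + 1))
    (T.isolated (j + 1)).1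
  exact not_isIsolatedIn_of_specializes hζ hne hζS (T.isolated (j + 1))

/-- **COROLLARY (KERNEL, PROVED): NO FORCED TOWER OF WEIGHT TWO PASSES THROUGH A DOUBLE POINT WITH A DIM-4 SUCCESSOR** —
`¬ DoublePointTower T` for every forced tower over every field with `IsDatum 2`. [folklore] -/
theorem no_doublePointTower (T : ForcedTower) (g : T.St 0 ⟶ Spec (.of k)) (hB : IsBase (T.St 0) g)
    (hD : IsDatum 2 (T.D 0)) : ¬ DoublePointTower T := fun ⟨j, h, h4⟩ =>
  no_successor_of_doublePointAt T g hB hD j h h4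

end HeightTowers

end Summit.ResolutionOfSingularities.ResolutionOfSingularities.Theorems.HugValuationCut
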